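import Summits.CriticalPhenomena.PercolationContinuityZ3.Theorems.PercNearOneGluingNoHeavyLowerTailSuperTerminalP3LamDvec
import Summits.CriticalPhenomena.PercolationContinuityZ3.Theorems.PercNearOneGluingNoHeavyLowerTailSuperTerminalQuarticStable
import HarnessLib

/-!
# THEOREM A in down-set coordinates and the super-terminal quartic law `V4` of one-pair graphs

Support file for crux `stmt-CriticalPhenomena-4575` (`NoHeavyLowerTail`), seat `prim-l12-p1` gen 32 (`--supports stmt-CriticalPhenomena-4575`);
graph-level assembly of THEOREM A/B (lead gen 134: `V4` reduces to `{s,a,b,c}`-primes), part 1 of 2 (part 2: `…SuperTerminalQuarticGluing`).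
No definitions, no sorries, standard axioms.

THE ROW.  Bond percolation `μ = prodBernoulli w` on a finite vertex type `V`, pairwise distinct terminals `s a b c`; `F = {s↔a} ∩ {s↮b}`,
`I = c ∤ {s,a,b}`, `IA = c ∤ {s,a}`, `IB = {c↮b}`.  The SUPER-TERMINAL QUARTIC LAW `V4` (`SuperTerminalQuarticFace`) is
`μ(F ∩ I)⁴ ≤ μ(F ∩ IA)²·μ(F ∩ IB)²·μ(I)`; it implies the face row `P3½`, hence `TCB` and `TT-CHORD(E₃)`.  THEOREM A
(`SuperTerminalQuarticStable.quartic_stable`, lead gen 134): `V4` is stable under parallel composition at `{s,a,b,c}` modulo the sextic law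
`(Q6)_c` of the `s–a`-glued pieces — a theorem for every finite weighted graph (`SuperTerminalDownsets.sextic_law`).

In the down-set coordinates `dk(u)` of `…SuperTerminalDownsets` / `…SuperTerminalDownsetEvents` (`Q = d1−d0`, `A = d2−d3`, `B = d4−d5−d6+d0`,
`C = d7`) this file proves:
* `dvec_quartic_mul` — `quartic_stable` in down-set coordinates: order relations + `V4` + `(Q6)_c` for two vectors ⟹ `V4` for the product;
* `v4_iff` — the event form of `V4` is the down-set form `(d1−d0)⁴ ≤ (d2−d3)²(d4−d5−d6+d0)²d7`;
* `v4_single` — a one-pair graph satisfies `V4` (if the pair is `s(s,a)` then `μ(F∩IA) = μ(F∩IB) = μ(F∩I)` and `μ(I) = 1`; otherwise `μ(F∩I) = 0`).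
-/

namespace Summit.CriticalPhenomena.PercolationContinuityZ3.Theorems.SuperTerminalQuarticDvec

open MeasureTheory Set
open Literature.Probability.Percolation Literature.Probability.Percolation.PartitionGluing
open Literature.Probability.LatticeModels (prodBernoulli)
open SuperTerminalDownsets SuperTerminalDownsetEvents SuperTerminalP3LamDvec
open scoped Classical

variable {V : Type*} [Fintype V]

/-- The ORDER RELATIONS of a down-set vector (as in `…SuperTerminalP3LamDvec`).  Local notation only. -/
local notation "Core[" x0 "," x1 "," x2 "," x3 "," x4 "," x5 "," x6 "," x7 "]" =>
  (((0 : ℝ) ≤ x0 ∧ x0 ≤ x1 ∧ x0 ≤ x3 ∧ x0 ≤ x5 ∧ x0 ≤ x6 ∧ (0 : ℝ) ≤ x7 ∧ x7 ≤ 1 ∧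
      (0 : ℝ) ≤ x2 - x3 - x1 + x0 ∧ (0 : ℝ) ≤ x4 - x5 - x6 + x0 - x1 + x0) : Prop)

/-- `V4` in down-set coordinates: `Q⁴ ≤ A²B²C` with `Q = d1−d0`, `A = d2−d3`, `B = d4−d5−d6+d0`, `C = d7`.  Local notation only. -/
local notation "V4row[" x0 "," x1 "," x2 "," x3 "," x4 "," x5 "," x6 "," x7 "]" =>
  (((x1 - x0) ^ 4 ≤ (x2 - x3) ^ 2 * (x4 - x5 - x6 + x0) ^ 2 * x7) : Prop)

/-- The sextic law `(Q6)_c` of the `sa`-glued graph in down-set coordinates: `d1⁶ ≤ d7²d2³d4³`.  Local notation only. -/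
local notation "Sextic[" x1 "," x2 "," x4 "," x7 "]" => ((x1 ^ 6 ≤ x7 ^ 2 * x2 ^ 3 * x4 ^ 3) : Prop)

/-- **THEOREM A in down-set coordinates**: if two down-set vectors satisfy the order relations, `V4` and `(Q6)_c`, then their coordinatewise
product satisfies `V4` (`SuperTerminalQuarticStable.quartic_stable`). [this work] -/
theorem dvec_quartic_mul {d0 d1 d2 d3 d4 d5 d6 d7 e0 e1 e2 e3 e4 e5 e6 e7 : ℝ}
    (hd : Core[d0, d1, d2, d3, d4, d5, d6, d7]) (hV : V4row[d0, d1, d2, d3, d4, d5, d6, d7]) (hS : Sextic[d1, d2, d4, d7])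
    (he : Core[e0, e1, e2, e3, e4, e5, e6, e7]) (gV : V4row[e0, e1, e2, e3, e4, e5, e6, e7]) (gS : Sextic[e1, e2, e4, e7]) :
    V4row[d0 * e0, d1 * e1, d2 * e2, d3 * e3, d4 * e4, d5 * e5, d6 * e6, d7 * e7] := by
  obtain ⟨h0, h1, h3, h5, h6, h7, -, hζ, hτ⟩ := hd
  obtain ⟨g0, g1, g3, g5, g6, g7, -, gζ, gτ⟩ := he
  have T := SuperTerminalQuarticStable.quartic_stable (n := d0) (σ := d1 - d0) (ζ := d2 - d3 - d1 + d0) (β := d3 - d0) (ξs := d5 - d0)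
    (ξa := d6 - d0) (τ := d4 - d5 - d6 + d0 - d1 + d0) (γ := d7)
    (n' := e0) (σ' := e1 - e0) (ζ' := e2 - e3 - e1 + e0) (β' := e3 - e0) (ξs' := e5 - e0) (ξa' := e6 - e0)
    (τ' := e4 - e5 - e6 + e0 - e1 + e0) (γ' := e7)
    h0 (by linarith) hζ (by linarith) (by linarith) (by linarith) hτ h7
    g0 (by linarith) gζ (by linarith) (by linarith) (by linarith) gτ g7
    (by convert hV using 2; ring) (by convert hS using 2 <;> ring) (by convert gV using 2; ring) (by convert gS using 2 <;> ring)
  convert T using 2 <;> ring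

section Weight
variable {s a b c : V}

/-- `V4` at the event level is `V4` in down-set coordinates (part 2: `real_F_inter_I`, `real_F_inter_IA`, `real_F_inter_IB`). [this work] -/
theorem v4_iff (u : Sym2 V → unitInterval) (s a b c : V) :
    (prodBernoulli u).real (openConn s a ∩ (openConn s b)ᶜ ∩ ((openConn c s)ᶜ ∩ (openConn c a)ᶜ ∩ (openConn c b)ᶜ) : Set (BondConfig V)) ^ 4 ≤
      (prodBernoulli u).real (openConn s a ∩ (openConn s b)ᶜ ∩ ((openConn c s)ᶜ ∩ (openConn c a)ᶜ) : Set (BondConfig V)) ^ 2 *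
      (prodBernoulli u).real (openConn s a ∩ (openConn s b)ᶜ ∩ (openConn c b)ᶜ : Set (BondConfig V)) ^ 2 *
      (prodBernoulli u).real ((openConn c s)ᶜ ∩ (openConn c a)ᶜ ∩ (openConn c b)ᶜ : Set (BondConfig V)) ↔
    V4row[(prodBernoulli u).real ((openConn s a)ᶜ ∩ (openConn s b)ᶜ ∩ (openConn s c)ᶜ ∩ (openConn a b)ᶜ ∩ (openConn a c)ᶜ ∩ (openConn b c)ᶜ),
      (prodBernoulli u).real ((openConn s b)ᶜ ∩ (openConn s c)ᶜ ∩ (openConn a b)ᶜ ∩ (openConn a c)ᶜ ∩ (openConn b c)ᶜ),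
      (prodBernoulli u).real ((openConn s b)ᶜ ∩ (openConn s c)ᶜ ∩ (openConn a b)ᶜ ∩ (openConn a c)ᶜ),
      (prodBernoulli u).real ((openConn s a)ᶜ ∩ (openConn s b)ᶜ ∩ (openConn s c)ᶜ ∩ (openConn a b)ᶜ ∩ (openConn a c)ᶜ),
      (prodBernoulli u).real ((openConn s b)ᶜ ∩ (openConn a b)ᶜ ∩ (openConn b c)ᶜ),
      (prodBernoulli u).real ((openConn s a)ᶜ ∩ (openConn s b)ᶜ ∩ (openConn a b)ᶜ ∩ (openConn a c)ᶜ ∩ (openConn b c)ᶜ),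
      (prodBernoulli u).real ((openConn s a)ᶜ ∩ (openConn s b)ᶜ ∩ (openConn s c)ᶜ ∩ (openConn a b)ᶜ ∩ (openConn b c)ᶜ),
      (prodBernoulli u).real ((openConn c s)ᶜ ∩ (openConn c a)ᶜ ∩ (openConn c b)ᶜ)] := by
  rw [real_F_inter_I u s a b c, real_F_inter_IA u s a b c, real_F_inter_IB u s a b c]

/-- **A one-pair graph satisfies `V4`**: for `u = w·1_{e}`, if `e ≠ s(s,a)` then `μ(F ∩ I) ≤ μ(s↔a) = 0`; if `e = s(s,a)` then the port is a.s.
isolated, so `μ(F∩IA) = μ(F∩IB) = μ(F∩I)` and `μ(I) = 1`, and `V4` holds with equality. [this work] -/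
theorem v4_single (w : Sym2 V → unitInterval) (hd : s ≠ a ∧ s ≠ b ∧ s ≠ c ∧ a ≠ b ∧ a ≠ c ∧ b ≠ c) (e : Sym2 V) :
    (prodBernoulli fun e' => if e' = e then w e' else 0).real
        (openConn s a ∩ (openConn s b)ᶜ ∩ ((openConn c s)ᶜ ∩ (openConn c a)ᶜ ∩ (openConn c b)ᶜ) : Set (BondConfig V)) ^ 4 ≤
      (prodBernoulli fun e' => if e' = e then w e' else 0).real
        (openConn s a ∩ (openConn s b)ᶜ ∩ ((openConn c s)ᶜ ∩ (openConn c a)ᶜ) : Set (BondConfig V)) ^ 2 *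
      (prodBernoulli fun e' => if e' = e then w e' else 0).real (openConn s a ∩ (openConn s b)ᶜ ∩ (openConn c b)ᶜ : Set (BondConfig V)) ^ 2 *
      (prodBernoulli fun e' => if e' = e then w e' else 0).real ((openConn c s)ᶜ ∩ (openConn c a)ᶜ ∩ (openConn c b)ᶜ : Set (BondConfig V)) := by
  set u : Sym2 V → unitInterval := fun e' => if e' = e then w e' else 0 with hu_def
  have hu : ∀ e', e' ≠ e → (u e' : ℝ) = 0 := fun e' h => by simp [hu_def, h]
  set F : Set (BondConfig V) := openConn s a ∩ (openConn s b)ᶜ with hF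
  set I : Set (BondConfig V) := (openConn c s)ᶜ ∩ (openConn c a)ᶜ ∩ (openConn c b)ᶜ with hI
  set Q := (prodBernoulli u).real (F ∩ I) with hQ
  have hQ0 : 0 ≤ Q := measureReal_nonneg
  by_cases hsa : s(s, a) = e
  · have hcs : (prodBernoulli u).real (openConn c s) = 0 :=
      real_openConn_eq_zero_of_single u e hu (Ne.symm hd.2.2.1) (by
        rw [← hsa]; intro h
        rcases Sym2.eq_iff.1 h with ⟨h1, -⟩ | ⟨h1, -⟩
        · exact hd.2.2.1 h1.symm
        · exact hd.2.2.2.2.1 h1.symm)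
    have hca : (prodBernoulli u).real (openConn c a) = 0 :=
      real_openConn_eq_zero_of_single u e hu (Ne.symm hd.2.2.2.2.1) (by
        rw [← hsa]; intro h
        rcases Sym2.eq_iff.1 h with ⟨h1, -⟩ | ⟨-, h2⟩
        · exact hd.2.2.1 h1.symm
        · exact hd.1 h2.symm)
    have hcb : (prodBernoulli u).real (openConn c b) = 0 :=
      real_openConn_eq_zero_of_single u e hu (Ne.symm hd.2.2.2.2.2) (by
        rw [← hsa]; intro h
        rcases Sym2.eq_iff.1 h with ⟨h1, -⟩ | ⟨-, h2⟩
        · exact hd.2.2.1 h1.symm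
        · exact hd.2.1 h2.symm)
    -- `μ(F∩IA) = μ(F∩IB) = Q` and `μ(I) = 1`
    have hA : (prodBernoulli u).real (F ∩ ((openConn c s)ᶜ ∩ (openConn c a)ᶜ)) = Q := by
      refine le_antisymm ?_ (measureReal_mono (by rintro ω ⟨hf, ⟨h1, h2⟩, -⟩; exact ⟨hf, h1, h2⟩))
      have hsub : F ∩ ((openConn c s)ᶜ ∩ (openConn c a)ᶜ) ⊆ (F ∩ I) ∪ openConn c b := by
        rintro ω ⟨hf, h1, h2⟩
        by_cases hb : ω ∈ openConn c b
        · exact Or.inr hb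
        · exact Or.inl ⟨hf, ⟨h1, h2⟩, hb⟩
      calc (prodBernoulli u).real (F ∩ ((openConn c s)ᶜ ∩ (openConn c a)ᶜ)) ≤ (prodBernoulli u).real ((F ∩ I) ∪ openConn c b) :=
            measureReal_mono hsub
        _ ≤ Q + (prodBernoulli u).real (openConn c b) := measureReal_union_le _ _
        _ = Q := by rw [hcb, add_zero]
    have hB : (prodBernoulli u).real (F ∩ (openConn c b)ᶜ) = Q := by
      refine le_antisymm ?_ (measureReal_mono (by rintro ω ⟨hf, -, h3⟩; exact ⟨hf, h3⟩))
      have hsub : F ∩ (openConn c b)ᶜ ⊆ (F ∩ I) ∪ (openConn c s ∪ openConn c a) := by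
        rintro ω ⟨hf, h3⟩
        by_cases h1 : ω ∈ openConn c s
        · exact Or.inr (Or.inl h1)
        by_cases h2 : ω ∈ openConn c a
        · exact Or.inr (Or.inr h2)
        · exact Or.inl ⟨hf, ⟨h1, h2⟩, h3⟩
      calc (prodBernoulli u).real (F ∩ (openConn c b)ᶜ) ≤ (prodBernoulli u).real ((F ∩ I) ∪ (openConn c s ∪ openConn c a)) :=
            measureReal_mono hsub
        _ ≤ Q + (prodBernoulli u).real (openConn c s ∪ openConn c a) := measureReal_union_le _ _
        _ ≤ Q + ((prodBernoulli u).real (openConn c s) + (prodBernoulli u).real (openConn c a)) :=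
            add_le_add le_rfl (measureReal_union_le _ _)
        _ = Q := by rw [hcs, hca]; ring
    have hC : (prodBernoulli u).real I = 1 := by
      have hIc : (prodBernoulli u).real Iᶜ = 0 := by
        refine le_antisymm ?_ measureReal_nonneg
        have hsub : Iᶜ ⊆ (openConn c s ∪ openConn c a) ∪ openConn c b := by
          intro ω hω
          rw [hI] at hω
          simp only [mem_compl_iff, mem_inter_iff, not_and, not_not, mem_union] at hω ⊢
          tauto
        calc (prodBernoulli u).real Iᶜ ≤ (prodBernoulli u).real ((openConn c s ∪ openConn c a) ∪ openConn c b) := measureReal_mono hsub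
          _ ≤ (prodBernoulli u).real (openConn c s ∪ openConn c a) + (prodBernoulli u).real (openConn c b) := measureReal_union_le _ _
          _ ≤ (prodBernoulli u).real (openConn c s) + (prodBernoulli u).real (openConn c a) + (prodBernoulli u).real (openConn c b) :=
              add_le_add (measureReal_union_le _ _) le_rfl
          _ = 0 := by rw [hcs, hca, hcb]; ring
      have h := measureReal_compl (μ := prodBernoulli u) (s := I) MeasurableSet.of_discrete
      rw [probReal_univ, hIc] at h
      linarith
    rw [hA, hB, hC]
    exact le_of_eq (by ring)
  · have hQz : Q = 0 :=
      le_antisymm ((measureReal_mono (show F ∩ I ⊆ openConn s a from fun ω hω => hω.1.1)).trans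
        (real_openConn_eq_zero_of_single u e hu hd.1 hsa).le) hQ0
    rw [hQz]
    have : (0 : ℝ) ^ 4 = 0 := by norm_num
    rw [this]
    exact mul_nonneg (mul_nonneg (sq_nonneg _) (sq_nonneg _)) measureReal_nonneg

end Weight

end Summit.CriticalPhenomena.PercolationContinuityZ3.Theorems.SuperTerminalQuarticDvec
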